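import Summits.AnomalousDissipation.AnomalousDissipation.Theorems.SawtoothPulseCascadeK1LocalisedCascadeEnergyLedgerStep
import Summits.AnomalousDissipation.AnomalousDissipation.Theorems.SawtoothPulseCascadeK1LocalisedCascadeFinalGlue

/-!
# K1loc, line `Spectral` / SeqCone — helper: THE ENERGY LEDGER CHAINED TO THE STUB'S INEQUALITY (S-C′ bookkeeping, end to end)

Helper file of the prover lane on the crux `K1LocalisedCascade` (stmt-AnomalousDissipation-19491), route
`SawtoothPulseCascade`, registered stub `stub_highModeConcentration` (memo v7 §2 (iv)–(v)).

`stub_form_of_energy_ledger`: the real bookkeeping from the per-slot ledger inequalities to the stub's inequality, for a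
classical scalar `w` on `[0,1)` advected by ANY smooth divergence-free drift with diffusivity `κ ≥ 0`:
if `T : ℕ → ℝ` (the tracked bad-symbol amplitudes, `0 ≤ T s ≤ B`) satisfies `T (s+1)² ≤ (T s + a s)² + b s` for
`s₀ ≤ s < S` (`…EnergyStepH/V`), the first good piece gives `T s₀² ≤ q₀` (S-D), the end of the ledger gives
`E_low(w(t_S)) ≤ T S² + e` (`…EnergyLedgerStep.lowModeEnergy_le_of_ledger_end`), and the budget closes,
`q₀ + Σ_{s₀≤s<S} (2B·a s + (a s)² + b s) + e ≤ (1 − 2χ)‖w 0‖²`, then at time `t_S ∈ [0,1)` and threshold `K`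
  `ofReal(2χ‖w 0‖²) ≤ highModeEnergy i K (w t_S) + 2·eScalarDissipation κ w 0 t_S`
(`…ZoneReadmit.sq_ledger_le` + `…FinalGlue.stub_form_of_lowModeEnergy_le`).  With `i = 0`, `w 0 = datum`,
`t_S = tStart (Jrate (γ²−3) κ + A)` and `1 ≤ 8π²κK²·tHalf(…)` this is literally the body of `stub_highModeConcentration`.

WHAT THIS IS NOT: no statement about the cascade's cut-offs or symbols (S-B), nor the first good piece (S-D); pure bookkeeping.
[cite: DEIJ2022, (1.2)–(1.3) (dissipated fraction of the variance)] [cite: Grafakos2014, Prop. 3.2.7 (3)] [problem: turb]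
-/

-- `Summit.<Summit>.<Problem>`: single-conjunct summit, the duplicate namespace segment is deliberate.
set_option linter.dupNamespace false

noncomputable section

namespace Summit.AnomalousDissipation.AnomalousDissipation.Theorems.SawtoothPulseCascade.K1Slot

open MeasureTheory Set Filter Topology UnitAddTorus
open scoped ENNReal
open Literature.Analysis Literature.Analysis.FunctionSpaces Literature.Analysis.FunctionSpaces.Torus
open Literature.Analysis.FluidPDE.Torus (highModeEnergy)

variable {d : Type*} [Fintype d] [DecidableEq d]

/-- **The energy ledger, end to end (bookkeeping).**  See the module docstring: per-slot steps
`T (s+1)² ≤ (T s + a s)² + b s` on `[s₀, S)`, `0 ≤ a`, `T ≤ B`, first good piece `T s₀² ≤ q₀`, ledger end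
`E_low(w t_S) ≤ T S² + e`, and the budget `q₀ + Σ (2B a + a² + b) + e ≤ (1 − 2χ)‖w 0‖²` give the stub's inequality at
`(K, t_S)`. [cite: DEIJ2022, (1.2)–(1.3)] -/
theorem stub_form_of_energy_ledger {κ : ℝ} (hκ : 0 ≤ κ) {u : ℝ → UnitAddTorus d → EuclideanSpace ℝ d}
    {w : ℝ → UnitAddTorus d → ℝ} (hw : FluidPDE.Torus.IsClassicalScalarTransportOn (Ico 0 1) κ u w)
    {tS : ℝ} (htS0 : 0 ≤ tS) (htS1 : tS < 1) (i : d) (K : ℝ) {χ : ℝ}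
    {T a b : ℕ → ℝ} {B q₀ e : ℝ} {s₀ S : ℕ} (hs : s₀ ≤ S) (hTB : ∀ s, T s ≤ B) (ha : ∀ s, 0 ≤ a s)
    (hstep : ∀ s, s₀ ≤ s → T (s + 1) ^ 2 ≤ (T s + a s) ^ 2 + b s) (hT4 : T s₀ ^ 2 ≤ q₀)
    (hend : ∑' k, (if |((k i : ℤ) : ℝ)| < K then (1 : ℝ) else 0) * ‖mFourierCoeff (fun x => (w tS x : ℂ)) k‖ ^ 2 ≤
      T S ^ 2 + e)
    (hbudget : q₀ + (∑ s ∈ Finset.Ico s₀ S, (2 * B * a s + a s ^ 2 + b s)) + e ≤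
      (1 - 2 * χ) * FluidPDE.Torus.scalarL2Sq (w 0)) :
    ENNReal.ofReal (2 * χ * FluidPDE.Torus.scalarL2Sq (w 0)) ≤
      highModeEnergy i K (w tS) + 2 * FluidPDE.Torus.eScalarDissipation κ w 0 tS := by
  have hledger := sq_ledger_le (T := T) (a := a) (b := b) (B := B) (i₀ := s₀) hTB ha hstep hs
  refine stub_form_of_lowModeEnergy_le hκ hw htS0 htS1 i K ?_
  linarith

end Summit.AnomalousDissipation.AnomalousDissipation.Theorems.SawtoothPulseCascade.K1Slot
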